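import Mathlib
import Literature.Analysis.FluidPDE.ClassicalSuitable
import Literature.Analysis.FluidPDE.NSSuitableESSProofs
import Literature.Analysis.FluidPDE.VorticityCalculus
import Literature.Analysis.FluidPDE.SereginZajaczkowski2007
import Summits.NavierStokesRegularity.NavierStokesRegularity.Theorems.EulerZoomLiouvillePowerGaugeEulerLiouvilleTimePeriodicTools
import Summits.NavierStokesRegularity.NavierStokesRegularity.Theorems.EulerZoomLiouvillePowerGaugeEulerLiouvilleCompactVortexVolumeEnergy
import HarnessLib

/-!
# ENERGY SLAVING of a classical compact-vortex member: slice energy ≤ C · (vortex volume)^{2/3} · enstrophy, and its time integral under the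
# `E`-gauge (crux `EulerZoomLiouville.PowerGaugeEulerLiouville` = stmt-NavierStokesRegularity-19832; line `vortex-volume` of ns-idea-11,
# tools for stub V3 `stub_starvedVortexEndgame`)

Route `EulerZoomLiouville` (NavierStokesRegularity); width seat ns-ezl-w1 on the interim LEAD ns-typeII-p2 g10's assignment (V2 → V1 → V1b → V3).
Two bookkeeping lemmas between the volume-slaving inequality V2 (`CompactVortex.vortexVolumeEnergyIneq`) and the starvation endgame V3:

* `CompactVortex.lintegral_enorm_curl_sq_le` — `∫‖curl v‖² ≤ ‖curlCLM‖² ∫_{B_b} |Dv|²_F` when `supp curl v ⊆ B_b`;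
* `CompactVortex.lintegral_enorm_sq_le_of_repr` — SLICE SLAVING: `v ∈ C¹`, `v = K₃ ∗ curl v`, `supp curl v ⊆ B_b` compact ⇒
  `∫‖v‖² ≤ C · vol(supp curl v)^{2/3} · ‖curlCLM‖² · ∫_{B_b}|Dv|²_F` (`C` the constant of V2);
* `CompactVortex.lintegral_window_energy_le` — WINDOW SLAVING UNDER THE `E`-GAUGE: for a classical member with weak gradient `H` and
  `a^ρ E(a;0;H) ≤ c`, whose slices on the window `τ ∈ (−T, 0)` are their Biot–Savart fields with vorticity supported in `B_b` of volume `≤ V`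
  (`V < ∞`, `b ≤ b'`, `T ≤ b'²`, `b' > 0`): `∫_{−T}^{0} ∫‖u(τ)‖² dτ ≤ C V^{2/3} ‖curlCLM‖² · c b'^{1−ρ}` (`H = ∇u` a.e. on the slab by uniqueness of weak
  gradients, `hasWeakSpatialGradientOn_of_contDiffOn` + `HasWeakSpatialGradientOn.ae_eq`; Tonelli; the window form of the gauge
  `TimePeriodic.setLIntegral_window_le_of_gaugeE`).

WHAT THIS IS NOT: not NS, not E, not V3 itself — `--supports` stmt-19832. [folklore]
-/

noncomputable section

-- flat `Theorems/<Route><Decl>…` files of one crux share the namespace of the crux (tree convention: `Summit.<S>.<S>.…`)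
set_option linter.dupNamespace false

open MeasureTheory Set Filter Topology Metric Function TopologicalSpace
open scoped ENNReal NNReal ContDiff

namespace Summit.NavierStokesRegularity.NavierStokesRegularity.Theorems.PowerGaugeEulerLiouville

open Literature.Analysis Literature.Analysis.FunctionSpaces Literature.Analysis.FluidPDE
open Summit.NavierStokesRegularity.NavierStokesRegularity.Theorems.PowerGaugeEulerLiouville.TimePeriodic
  (setLIntegral_window_le_of_gaugeE)

namespace CompactVortex

/-! ### Enstrophy through the Frobenius energy of the gradient on the support ball -/

/-- `∫‖curl v‖² ≤ ‖curlCLM‖² ∫_{B_b} |Dv|²_F` when `supp (curl v) ⊆ B(0, b)` (`‖curl v(x)‖² ≤ ‖curlCLM‖² |Dv(x)|²_F` pointwise, tree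
`norm_curl_sq_le_frobeniusNormSq`). [folklore] -/
theorem lintegral_enorm_curl_sq_le (v : EuclideanSpace ℝ (Fin 3) → EuclideanSpace ℝ (Fin 3)) {b : ℝ}
    (hsupp : Function.support (curl v) ⊆ ball (0 : EuclideanSpace ℝ (Fin 3)) b) :
    ∫⁻ x, ‖curl v x‖ₑ ^ 2 ≤ ENNReal.ofReal (‖curlCLM‖ ^ 2) *
      ∫⁻ x in ball (0 : EuclideanSpace ℝ (Fin 3)) b, ENNReal.ofReal (frobeniusNormSq (fderiv ℝ v x)) := by
  have hsupp2 : Function.support (fun x => ‖curl v x‖ₑ ^ 2) ⊆ ball (0 : EuclideanSpace ℝ (Fin 3)) b := by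
    intro x hx
    apply hsupp
    rw [Function.mem_support] at hx ⊢
    intro h0
    exact hx (by rw [h0, enorm_zero, zero_pow two_ne_zero])
  have hpt : ∀ x, ‖curl v x‖ₑ ^ 2 ≤
      ENNReal.ofReal (‖curlCLM‖ ^ 2) * ENNReal.ofReal (frobeniusNormSq (fderiv ℝ v x)) := by
    intro x
    rw [← ofReal_norm, ← ENNReal.ofReal_pow (norm_nonneg _), ← ENNReal.ofReal_mul (sq_nonneg _)]
    exact ENNReal.ofReal_le_ofReal (norm_curl_sq_le_frobeniusNormSq v x)
  calc ∫⁻ x, ‖curl v x‖ₑ ^ 2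
      = ∫⁻ x, (ball (0 : EuclideanSpace ℝ (Fin 3)) b).indicator (fun x => ‖curl v x‖ₑ ^ 2) x := by
        rw [Set.indicator_eq_self.2 hsupp2]
    _ ≤ ∫⁻ x in ball (0 : EuclideanSpace ℝ (Fin 3)) b, ‖curl v x‖ₑ ^ 2 := lintegral_indicator_le _ _
    _ ≤ ∫⁻ x in ball (0 : EuclideanSpace ℝ (Fin 3)) b,
          ENNReal.ofReal (‖curlCLM‖ ^ 2) * ENNReal.ofReal (frobeniusNormSq (fderiv ℝ v x)) :=
        lintegral_mono fun x => hpt x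
    _ = _ := lintegral_const_mul' _ _ ENNReal.ofReal_ne_top

/-! ### Slice slaving -/

/-- **SLICE ENERGY SLAVING.**  If `v ∈ C¹(ℝ³)` is its Biot–Savart field, `v = K₃ ∗ curl v`, with `curl v` compactly supported inside
`B(0, b)`, then `∫‖v‖² ≤ C · vol(supp curl v)^{2/3} · (‖curlCLM‖² ∫_{B_b} |Dv|²_F)`, `C` the constant of the volume-slaving inequality
(`CompactVortex.vortexVolumeEnergyIneq`, passed as a hypothesis so that any admissible constant can be used). [folklore] -/
theorem lintegral_enorm_sq_le_of_repr {C : ℝ≥0}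
    (hC : ∀ W : EuclideanSpace ℝ (Fin 3) → EuclideanSpace ℝ (Fin 3), Continuous W → HasCompactSupport W →
      ∫⁻ x, ‖biotSavart W x‖ₑ ^ 2 ≤
        (C : ℝ≥0∞) * volume (Function.support W) ^ (2 / 3 : ℝ) * ∫⁻ x, ‖W x‖ₑ ^ 2)
    {v : EuclideanSpace ℝ (Fin 3) → EuclideanSpace ℝ (Fin 3)} (hv : ContDiff ℝ 1 v)
    (hωc : HasCompactSupport (curl v)) (hrepr : v = biotSavart (curl v)) {b : ℝ}
    (hsupp : Function.support (curl v) ⊆ ball (0 : EuclideanSpace ℝ (Fin 3)) b) :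
    ∫⁻ x, ‖v x‖ₑ ^ 2 ≤ (C : ℝ≥0∞) * volume (Function.support (curl v)) ^ (2 / 3 : ℝ) *
      (ENNReal.ofReal (‖curlCLM‖ ^ 2) *
        ∫⁻ x in ball (0 : EuclideanSpace ℝ (Fin 3)) b, ENNReal.ofReal (frobeniusNormSq (fderiv ℝ v x))) := by
  have h1 : ∫⁻ x, ‖v x‖ₑ ^ 2 = ∫⁻ x, ‖biotSavart (curl v) x‖ₑ ^ 2 := by rw [← hrepr]
  rw [h1]
  exact (hC (curl v) (continuous_curl hv) hωc).trans (mul_le_mul' le_rfl (lintegral_enorm_curl_sq_le v hsupp))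

/-! ### Window slaving under the `E`-gauge -/

/-- **WINDOW ENERGY SLAVING UNDER THE `E`-GAUGE.**  Let `(u, p)` be a classical Euler solution on `(−∞, 0)` with a weak spatial
gradient `H` on the slab and `a^{ρ} E(a; 0; H) ≤ c` for all `a > 0`; let `C` be a volume-slaving constant.  Suppose that on the window
`τ ∈ (−T, 0)` every slice is its Biot–Savart field with vorticity supported in `B(0, b)` of volume `≤ V`, where `0 < b'`, `b ≤ b'`,
`T ≤ b'²`.  Then `∫_{τ ∈ (−T,0)} ∫‖u(τ)‖² ≤ C V^{2/3} ‖curlCLM‖² · c b'^{1−ρ}`: slice slaving, `Du(τ) = H(τ)` a.e. on the slab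
(uniqueness of weak gradients), Tonelli, and the window form of the gauge `∫_{(−T,0)×B_b}|H|²_F ≤ c b'^{1−ρ}`. [folklore] -/
theorem lintegral_window_energy_le {ρ : ℝ}
    {u : ℝ → EuclideanSpace ℝ (Fin 3) → EuclideanSpace ℝ (Fin 3)} {p : ℝ → EuclideanSpace ℝ (Fin 3) → ℝ}
    {H : ℝ → EuclideanSpace ℝ (Fin 3) → EuclideanSpace ℝ (Fin 3) →L[ℝ] EuclideanSpace ℝ (Fin 3)} {c : ℝ≥0}
    (hcl : IsClassicalEulerSolutionOn (Iio 0) 0 u p)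
    (hH : HasWeakSpatialGradientOn (slab (EuclideanSpace ℝ (Fin 3)) (Iio 0) isOpen_Iio) u H)
    (hE : ∀ a : ℝ, 0 < a →
      ENNReal.ofReal (a ^ ρ) * cknE a (0 : ℝ × EuclideanSpace ℝ (Fin 3)) H ≤ (c : ℝ≥0∞))
    {C : ℝ≥0}
    (hC : ∀ W : EuclideanSpace ℝ (Fin 3) → EuclideanSpace ℝ (Fin 3), Continuous W → HasCompactSupport W →
      ∫⁻ x, ‖biotSavart W x‖ₑ ^ 2 ≤
        (C : ℝ≥0∞) * volume (Function.support W) ^ (2 / 3 : ℝ) * ∫⁻ x, ‖W x‖ₑ ^ 2)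
    (hrepr : ∀ τ : ℝ, τ < 0 → u τ = biotSavart (curl (u τ)))
    (hωc : ∀ τ : ℝ, τ < 0 → HasCompactSupport (curl (u τ)))
    {V : ℝ≥0∞} (hV : V ≠ ⊤) {T b b' : ℝ} (hb' : 0 < b') (hbb' : b ≤ b') (hT : T ≤ b' ^ 2)
    (hsupp : ∀ τ ∈ Ioo (-T) 0, Function.support (curl (u τ)) ⊆ ball (0 : EuclideanSpace ℝ (Fin 3)) b)
    (hvol : ∀ τ ∈ Ioo (-T) 0, volume (Function.support (curl (u τ))) ≤ V) :
    ∫⁻ τ in Ioo (-T) 0, ∫⁻ x, ‖u τ x‖ₑ ^ 2 ≤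
      (C : ℝ≥0∞) * V ^ (2 / 3 : ℝ) * ENNReal.ofReal (‖curlCLM‖ ^ 2) * ENNReal.ofReal ((c : ℝ) * b' ^ (1 - ρ)) := by
  -- ### the classical gradient is a weak gradient; `H = ∇u` a.e. on the slab
  set G : ℝ → EuclideanSpace ℝ (Fin 3) → EuclideanSpace ℝ (Fin 3) →L[ℝ] EuclideanSpace ℝ (Fin 3) :=
    fun t x => fderiv ℝ (u t) x with hGdef
  have hu1 : ContDiffOn ℝ 1 (uncurry u) (Iio (0 : ℝ) ×ˢ (univ : Set (EuclideanSpace ℝ (Fin 3)))) :=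
    hcl.smooth_velocity.of_le (by norm_cast)
  have hG : HasWeakSpatialGradientOn (slab (EuclideanSpace ℝ (Fin 3)) (Iio 0) isOpen_Iio) u G :=
    hasWeakSpatialGradientOn_of_contDiffOn isOpen_Iio (by intro z hz; exact ⟨mem_slab.1 hz, mem_univ _⟩) hu1
  have hae : ∀ᵐ z ∂(volume.restrict ((slab (EuclideanSpace ℝ (Fin 3)) (Iio 0) isOpen_Iio :
      Opens (ℝ × EuclideanSpace ℝ (Fin 3))) : Set (ℝ × EuclideanSpace ℝ (Fin 3)))), uncurry H z = uncurry G z :=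
    hH.ae_eq hG
  -- ### the window integral of `|∇u|²_F` is bounded by the gauge
  have hWsub : Ioo (-T) 0 ×ˢ ball (0 : EuclideanSpace ℝ (Fin 3)) b ⊆
      ((slab (EuclideanSpace ℝ (Fin 3)) (Iio 0) isOpen_Iio : Opens (ℝ × EuclideanSpace ℝ (Fin 3))) :
        Set (ℝ × EuclideanSpace ℝ (Fin 3))) := by
    intro z hz
    exact mem_slab.2 (mem_prod.1 hz).1.2
  have hwin : ∫⁻ z in Ioo (-T) 0 ×ˢ ball (0 : EuclideanSpace ℝ (Fin 3)) b,
      ENNReal.ofReal (frobeniusNormSq (G z.1 z.2)) ≤ ENNReal.ofReal ((c : ℝ) * b' ^ (1 - ρ)) := by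
    have h1 := setLIntegral_window_le_of_gaugeE (H := H) (ρ := ρ) (c := c) hb' hbb' hT (hE b' hb')
    refine le_trans (le_of_eq ?_) h1
    refine lintegral_congr_ae ?_
    have h2 := ae_restrict_of_ae_restrict_of_subset hWsub hae
    filter_upwards [h2] with z hz
    simp only [uncurry] at hz
    rw [hz]
  -- ### Tonelli on the window
  have hGm : AEStronglyMeasurable (uncurry G)
      (volume.restrict (Iio (0 : ℝ) ×ˢ (univ : Set (EuclideanSpace ℝ (Fin 3))))) := by
    have := hG.locallyIntegrableOn_grad.aestronglyMeasurable
    simpa [slab] using this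
  have hfm : Measurable fun L : EuclideanSpace ℝ (Fin 3) →L[ℝ] EuclideanSpace ℝ (Fin 3) =>
      ENNReal.ofReal (frobeniusNormSq L) :=
    (SereginZajaczkowski2007.continuous_frobeniusNormSq).measurable.ennreal_ofReal
  have hGmW : AEMeasurable (fun z : ℝ × EuclideanSpace ℝ (Fin 3) => ENNReal.ofReal (frobeniusNormSq (G z.1 z.2)))
      (((volume : Measure ℝ).restrict (Ioo (-T) 0)).prod
        ((volume : Measure (EuclideanSpace ℝ (Fin 3))).restrict (ball 0 b))) := by
    have hsub : Ioo (-T) 0 ×ˢ ball (0 : EuclideanSpace ℝ (Fin 3)) b ⊆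
        Iio (0 : ℝ) ×ˢ (univ : Set (EuclideanSpace ℝ (Fin 3))) :=
      prod_mono (fun t ht => ht.2) (subset_univ _)
    have := hfm.comp_aemeasurable (hGm.mono_measure (Measure.restrict_mono hsub le_rfl)).aemeasurable
    rwa [Measure.volume_eq_prod, ← Measure.prod_restrict] at this
  have htonelli : ∫⁻ τ in Ioo (-T) 0, ∫⁻ x in ball (0 : EuclideanSpace ℝ (Fin 3)) b,
        ENNReal.ofReal (frobeniusNormSq (fderiv ℝ (u τ) x)) =
      ∫⁻ z in Ioo (-T) 0 ×ˢ ball (0 : EuclideanSpace ℝ (Fin 3)) b, ENNReal.ofReal (frobeniusNormSq (G z.1 z.2)) := by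
    rw [Measure.volume_eq_prod, ← Measure.prod_restrict, lintegral_prod _ hGmW]
  -- ### slice slaving on the window and assembly
  set K : ℝ≥0∞ := (C : ℝ≥0∞) * V ^ (2 / 3 : ℝ) * ENNReal.ofReal (‖curlCLM‖ ^ 2) with hK
  have hKt : K ≠ ⊤ := ENNReal.mul_ne_top
    (ENNReal.mul_ne_top ENNReal.coe_ne_top (ENNReal.rpow_ne_top_of_nonneg (by norm_num) hV)) ENNReal.ofReal_ne_top
  have hslice : ∀ τ ∈ Ioo (-T) 0, ∫⁻ x, ‖u τ x‖ₑ ^ 2 ≤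
      K * ∫⁻ x in ball (0 : EuclideanSpace ℝ (Fin 3)) b, ENNReal.ofReal (frobeniusNormSq (fderiv ℝ (u τ) x)) := by
    intro τ hτ
    have hv1 : ContDiff ℝ 1 (u τ) := (hcl.contDiff_velocity hτ.2).of_le (by norm_cast)
    have h := lintegral_enorm_sq_le_of_repr hC hv1 (hωc τ hτ.2) (hrepr τ hτ.2) (hsupp τ hτ)
    refine h.trans ?_
    set I : ℝ≥0∞ := ∫⁻ x in ball (0 : EuclideanSpace ℝ (Fin 3)) b,
      ENNReal.ofReal (frobeniusNormSq (fderiv ℝ (u τ) x)) with hI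
    rw [hK]
    calc (C : ℝ≥0∞) * volume (Function.support (curl (u τ))) ^ (2 / 3 : ℝ) * (ENNReal.ofReal (‖curlCLM‖ ^ 2) * I)
        = (C : ℝ≥0∞) * volume (Function.support (curl (u τ))) ^ (2 / 3 : ℝ) * ENNReal.ofReal (‖curlCLM‖ ^ 2) * I := by
          ring
      _ ≤ (C : ℝ≥0∞) * V ^ (2 / 3 : ℝ) * ENNReal.ofReal (‖curlCLM‖ ^ 2) * I := by
          gcongr
          exact hvol τ hτ
  calc ∫⁻ τ in Ioo (-T) 0, ∫⁻ x, ‖u τ x‖ₑ ^ 2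
      ≤ ∫⁻ τ in Ioo (-T) 0, K * ∫⁻ x in ball (0 : EuclideanSpace ℝ (Fin 3)) b,
          ENNReal.ofReal (frobeniusNormSq (fderiv ℝ (u τ) x)) :=
        setLIntegral_mono' measurableSet_Ioo fun τ hτ => hslice τ hτ
    _ = K * ∫⁻ τ in Ioo (-T) 0, ∫⁻ x in ball (0 : EuclideanSpace ℝ (Fin 3)) b,
          ENNReal.ofReal (frobeniusNormSq (fderiv ℝ (u τ) x)) := by
        rw [lintegral_const_mul' _ _ hKt]
    _ ≤ K * ENNReal.ofReal ((c : ℝ) * b' ^ (1 - ρ)) := by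
        rw [htonelli]; exact mul_le_mul' le_rfl hwin
    _ = _ := by rw [hK]

end CompactVortex

end Summit.NavierStokesRegularity.NavierStokesRegularity.Theorems.PowerGaugeEulerLiouville
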